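import Literature.NumberTheory.Automorphic.RankinSelbergTowerFiniteness
import Literature.NumberTheory.Automorphic.SummableNormSqTraceSatakePowOfTorusFiniteness
import HarnessLib

/-!
# Jacquet–Shalika's (5.3.3)–(5.3.4) off an arbitrary `S` and the bound (5.1.3): the discharges

Topic `NumberTheory/Automorphic`; namespace `Literature.NumberTheory.Automorphic`. Proof file
(theorems only: no definition, no named fact, no instance), sibling of `AutomorphicLFunctionHolds`
(which discharged Jacquet–Shalika's Thm. (5.3) for the standard Euler product and (J) =
(5.3.3)–(5.3.4) off *large* finite sets, and deliberately left out the two facts below).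

H. Jacquet, J. A. Shalika, *On Euler products and the classification of automorphic
representations I*, Amer. J. Math. **103** (1981): for a (unitary) cuspidal automorphic
representation `Π` of `GL_n(𝔸_K)` with Satake classes `A_v` off `S`,

* **(5.3.3)–(5.3.4)** (proof of Thm. (5.3), p. 556): the Dirichlet series with non-negative
  coefficients `∑_{v ∉ S} ∑_{k ≥ 1} |tr A_v^k|² / (k q_v^{kσ})` converges for `σ > 1` — the named
  fact `summable_normSq_trace_satakePow` of `AutomorphicLFunctionProofs`, stated off an **arbitrary**
  set `S` carrying a Satake family;
* **(5.1.3)** (p. 554; in print from Cor. (2.5), p. 515, and Remark (2.6)(3)): `|μ_{j,v}| ≤ q_v^{1/2}`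
  for the Satake parameters at every unramified place — the named fact
  `norm_satakeParameter_le_sqrt` of `AutomorphicLFunctionProofs`.

Both are now theorems in **every rank** over **every number field**, by the tree's real-point
Rankin–Selberg method: `SummableNormSqTraceSatakePowOfTorusFiniteness` reduced both facts
(`summable_normSq_trace_satakePow_of_rankinSelbergTorusIntegral_ne_top`,
`norm_satakeParameter_le_sqrt_of_rankinSelbergTorusIntegral_ne_top`) to the single hypothesis
`hfin` — finiteness, for every real `σ > 1`, of the unfolded Rankin–Selberg torus integral of the
global Whittaker coefficient of every smoothed `L²` cusp form against the test function
`Φ_∞ ⊗ 𝟙_{𝒪̂ⁿ}` — the large-`S` part through the bounded torus-sum products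
(`JacquetShalikaSchurSelfSumOfTorusFiniteness`, the Cauchy identity for Schur polynomials) and the
pointwise part at the finitely many remaining unramified places through the finiteness of each
local unramified torus factor (`schurSelfSum_ne_top_of_finite_rankinSelberg`: a power series
`∑_λ |s_λ(A_v)|² q_v^{-|λ|σ}` finite for all `σ > 1` forces `|μ_{j,v}| ≤ q_v^{1/2}`), and
`RankinSelbergTowerFiniteness` proved `hfin` (`rankinSelbergTorusIntegral_whittakerCoeff_ne_top`,
with the archimedean test function `jsArchTestFun = e^{-‖·_∞‖}`: reduction theory, rapid decay of
cusp forms on Siegel sets, the mirabolic Eisenstein weight). This file only plugs the latter into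
the former, with the Haar measures and Borel structures chosen as in
`JacquetShalika1981_schurSelfSum_prod_bounded_holds` (inside the proof; no instance is declared):

* `summable_normSq_trace_satakePow_holds` — (5.3.3)–(5.3.4) off an arbitrary `S`, every rank
  (`n = 0`: `summable_normSq_trace_satakePow_of_le_one`);
* `norm_satakeParameter_le_sqrt_holds` — (5.1.3), every rank
  (`norm_satakeParameter_le_sqrt_of_summable`: `|μ_{j,v}| ≤ q_v^{σ/2}` for all `σ > 1`).

Consumers: every theorem of the tree carrying a hypothesis
`(h : summable_normSq_trace_satakePow)` or `(h : norm_satakeParameter_le_sqrt)` (the Godement–Jacquet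
files, `PairLFunctionPolesRankNeAssembly`, `PairLFunctionPolesRankNeGodementJacquet`,
`JacquetShalikaEulerProducts`, `PairLFunctionPolesChangeOfS`, …) is now fed by these two theorems.
Axioms: `propext`, `Classical.choice`, `Quot.sound`.

## References

* H. Jacquet, J. A. Shalika, *On Euler products and the classification of automorphic
  representations I*, Amer. J. Math. 103 (1981), 499–558: (5.1.3) p. 554, Thm. (5.3) p. 555 and
  its proof (5.3.3)–(5.3.4) p. 556, Cor. (2.5) p. 515, Remark (2.6)(3) [JacquetShalikaAJM1981].
* J. W. Cogdell, *Analytic theory of L-functions for GL_n*, in: J. Bernstein, S. Gelbart (eds.),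
  *An Introduction to the Langlands Program*, Birkhäuser (2004), §2.3, §4.1
  [CogdellAnalyticTheory2004].
-/

noncomputable section

open MeasureTheory Measure NumberField IsDedekindDomain
open scoped MatrixGroups ENNReal NNReal
open Literature.NumberTheory.GaloisRepresentations (ideleGroup)

namespace Literature.NumberTheory.Automorphic

section Discharges

variable {n : ℕ} {K : Type} [Field K] [NumberField K]
  {μ : Measure (AdelicGroupData.gl n K).automorphicQuotient}
  [(AdelicGroupData.gl n K).IsAutomorphicMeasure μ]

/-- **Jacquet–Shalika's (5.3.3)–(5.3.4) off an arbitrary `S`** — the named fact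
`summable_normSq_trace_satakePow` of `AutomorphicLFunctionProofs` is a theorem in every rank: for
every cuspidal automorphic representation `Π` of `GL_n(𝔸_K)`, every set `S` of finite places off
which `α` is a Satake family of `Π`, and every real `σ > 1`,
`∑_{v ∉ S} ∑_{k ≥ 1} |tr A_v^k|² / (k q_v^{kσ}) < ∞`. Rank `0` by
`summable_normSq_trace_satakePow_of_le_one`; rank `n ≥ 1` by
`summable_normSq_trace_satakePow_of_rankinSelbergTorusIntegral_ne_top` fed with the finiteness of the
unfolded Rankin–Selberg torus integral `rankinSelbergTorusIntegral_whittakerCoeff_ne_top` (Haar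
measures on `(𝔸_Kˣ)ⁿ`, `K_max`, `N_n(𝔸_K)`; test function `e^{-‖·_∞‖} ⊗ 𝟙_{𝒪̂ⁿ}`).
[cite: JacquetShalikaAJM1981, Thm. (5.3), proof, (5.3.3)–(5.3.4) p. 556] -/
theorem summable_normSq_trace_satakePow_holds : summable_normSq_trace_satakePow (μ := μ) := by
  rcases Nat.lt_or_ge n 1 with hn | hn
  · exact summable_normSq_trace_satakePow_of_le_one (by omega)
  -- Borel structures and topological facts, as the local instances of the Rankin–Selberg files
  letI : MeasurableSpace (AdelicGroupData.gl n K).Adelic := adelicBorel n K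
  haveI : BorelSpace (AdelicGroupData.gl n K).Adelic := borelSpace_adelic n K
  haveI : LocallyCompactSpace (AdelicGroupData.gl n K).Adelic := locallyCompactSpace_adelic n K
  haveI : SecondCountableTopology (AdelicGroupData.gl n K).Adelic :=
    secondCountableTopology_gl_adelic n K
  letI : MeasurableSpace (GL (Fin n) (AdeleRing (𝓞 K) K)) := glAdeleBorel n K
  haveI : BorelSpace (GL (Fin n) (AdeleRing (𝓞 K) K)) := borelSpace_glAdele n K
  letI : MeasurableSpace (ideleGroup K) := borel _
  haveI : BorelSpace (ideleGroup K) := ⟨rfl⟩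
  haveI := locallyCompactSpace_ideleGroup K
  haveI := secondCountableTopology_ideleGroup K
  haveI : T2Space (GL (Fin n) (AdeleRing (𝓞 K) K)) := t2Space_gl n K
  haveI : LocallyCompactSpace (GL (Fin n) (AdeleRing (𝓞 K) K)) :=
    AdelicGroupData.locallyCompactSpace_generalLinearGroup_adeleRing K (Fin n)
  haveI : CompactSpace ↥(maximalCompactAdelic n K) :=
    isCompact_iff_compactSpace.1 (isCompact_maximalCompactAdelic n K)
  haveI : LocallyCompactSpace ↥(adelicUnipotent n K) :=
    (isClosed_adelicUnipotent n K).locallyCompactSpace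
  set νA : Measure (Fin n → ideleGroup K) := Measure.haar
  set νK : Measure ↥(maximalCompactAdelic n K) := Measure.haar
  set ν₀ : Measure ↥(adelicUnipotent n K) := Measure.haar
  exact summable_normSq_trace_satakePow_of_rankinSelbergTorusIntegral_ne_top νA νK ν₀
    (continuous_jsArchTestFun n K) (jsArchTestFun_pos n K)
    (fun η hη f hf σ hσ => rankinSelbergTorusIntegral_whittakerCoeff_ne_top hn νA νK ν₀ hη hf hσ)

/-- **Jacquet–Shalika's bound (5.1.3)** — the named fact `norm_satakeParameter_le_sqrt` of
`AutomorphicLFunctionProofs` is a theorem in every rank: for every cuspidal automorphic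
representation `Π` of `GL_n(𝔸_K)`, every Satake family `α` of `Π` off `S`, every `v ∉ S` and every
`a ∈ α v`, `|a| ≤ q_v^{1/2}` ("`|μ_{j,v}| ≤ q_v^{1/2}`", loc. cit. (5.1.3); in print from the local
Cor. (2.5) and Remark (2.6)(3), here from the convergence of (5.3.3) for all `σ > 1`,
`norm_satakeParameter_le_sqrt_of_summable`). [cite: JacquetShalikaAJM1981, (5.1.3) p. 554] -/
theorem norm_satakeParameter_le_sqrt_holds : norm_satakeParameter_le_sqrt (μ := μ) :=
  norm_satakeParameter_le_sqrt_of_summable summable_normSq_trace_satakePow_holds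

end Discharges

end Literature.NumberTheory.Automorphic
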